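import Literature.MathematicalPhysics.QuantumLattice.GibbsTwoTimeBound
import Literature.MathematicalPhysics.QuantumLattice.FinDimSpectrumProofs
import HarnessLib

/-!
# Thermal slack of the ground-state stationarity (KKT) rows:
`Re ⟨Aᴴ[H,A]⟩_β ≥ β⁻¹(Re ⟨AᴴA⟩_β − Re ⟨AAᴴ⟩_β) ≥ −β⁻¹‖A‖²`

Topic `MathematicalPhysics/QuantumLattice`, finite-dimensional Gibbs states (`gibbsWeight`,
`gibbsState`, `partitionFn` of `FinDimSpectrum.lean`; eigenbasis bookkeeping of
`GibbsTwoTimeBound.lean`). For a Hermitian `H` on a finite-dimensional space, inverse temperature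
`β > 0` and ANY matrix `A`, the Gibbs state `⟨X⟩_β = Tr(e^{-βH} X)/Z` satisfies the linearised
energy–entropy-balance inequality

  `Re ⟨Aᴴ (HA − AH)⟩_β ≥ β⁻¹ (Re ⟨Aᴴ A⟩_β − Re ⟨A Aᴴ⟩_β) ≥ −β⁻¹ ‖A‖²`

(termwise in the eigenbasis of `H`: `e^{-βλⱼ}(λᵢ − λⱼ) ≥ β⁻¹ (e^{-βλⱼ} − e^{-βλᵢ})`, i.e.
`1 − e^{−x} ≤ x`). Every ground state `ω₀` satisfies the stationarity / second-order optimality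
(KKT) row `ω₀(Aᴴ[H,A]) = ω₀(Aᴴ(H − E₀)A) ≥ 0` EXACTLY (`re_dotProduct_conjTranspose_comm_mulVec_nonneg`
below, vector form); the headline says the Gibbs state at temperature `T = β⁻¹` violates each such
row by at most `T‖A‖²`, uniformly in the dimension of the space.

* `re_trace_gibbsWeight_mul_conjTranspose_mul_comm` — eigenbasis form
  `Re Tr(e^{-βH} Aᴴ(HA − AH)) = Σᵢⱼ e^{-βλⱼ}(λᵢ − λⱼ)|A'ᵢⱼ|²`, `A' = U⋆AU`;
* `inv_mul_sub_le_re_trace_gibbsWeight_comm`, `inv_mul_sub_le_re_gibbsState_comm` — the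
  linearised energy–entropy balance (trace and state forms);
* **`neg_inv_mul_norm_sq_le_re_gibbsState_comm`** — `−β⁻¹‖A‖² ≤ Re ⟨Aᴴ(HA − AH)⟩_β`;
* `dotProduct_conjTranspose_comm_mulVec_eq`, `re_dotProduct_conjTranspose_comm_mulVec_nonneg` —
  the ground-state side: `⟨ψ, Aᴴ(HA − AH)ψ⟩ = ⟨Aψ, (H − E₀)Aψ⟩ ≥ 0` whenever `Hψ = E₀ψ`.

Use (cell hubbard-cq, critic-1 obstruction O1): combined with Koma–Tasaki 1992 (no pair LRO at
any `T > 0` in dimension `≤ 2`, tree fact `PositiveTemperatureNoPairLRO`), every thermodynamic-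
limit FLOOR certificate for a weak-⋆-continuous order functional assembled from {energy window
`ε > 0`, finitely many KKT rows `ω(Aⱼᴴ[H,Aⱼ]) ≥ −δⱼ` with `δⱼ > 0`, positivity, translation
invariance, sector constraints} is satisfied by the Gibbs state `ω_T` for `T` small, and therefore
cannot conclude a positive floor. This file only supplies the finite-dimensional inequality; the
obstruction itself is bookkeeping on top of it and is not formalised here.

Design: everything is PROVED from scratch in the eigenbasis of `H` (no KMS / modular theory); no
definition is introduced. Deliberately NOT here: the full (logarithmic) energy–entropy-balance
inequality `ω(A⋆[H,A]) ≥ β⁻¹ ω(A⋆A) ln(ω(A⋆A)/ω(AA⋆))` of Fannes–Verbeure and its equivalence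
with the KMS condition (Bratteli–Robinson II, Thm 5.3.15) — the linearisation
`a ln(a/b) ≥ a − b` of it is what is proved directly; thermodynamic limits.

## Mathlib / tree search

Mathlib: `Matrix.IsHermitian.conjStarAlgAut_star_eigenvectorUnitary` (diagonalisation),
`Real.add_one_le_exp`, `CStarRing.norm_self_mul_star`; no Gibbs-state commutator inequality
(`lean search 'energy.entropy|gibbsState.*comm'`: none). Tree: `GibbsTwoTimeBound`
(`trace_gibbsWeight_mul_eq_sum`, `re_trace_gibbsWeight_mul_conjTranspose_mul`,
`re_trace_gibbsWeight_mul_mul_conjTranspose`, `re_trace_gibbsWeight_mul_le`), `DuhamelTwoPoint`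
(`IsHermitian.re_gibbsState`, `sum_exp_pos`, `partitionFn_eq_ofReal`), `FinDimSpectrum`
(`gibbsState_nonneg_of_posSemidef`), `FinDimSpectrumProofs` (`posSemidef_sub_groundEnergy`).

## References

* M. Fannes, A. Verbeure, *Correlation inequalities and equilibrium states*, Commun. Math. Phys.
  55 (1977) 125–131; II, Commun. Math. Phys. 57 (1977) 165–171 (energy–entropy balance ⇔ KMS).
  [FannesVerbeure1977]
* O. Bratteli, D. W. Robinson, *Operator Algebras and Quantum Statistical Mechanics II*, 2nd ed.
  (Springer 1997), Thm 5.3.15 (not held on this hub; the finite-dimensional statement below is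
  proved from scratch). [BratteliRobinsonII1997]
-/

noncomputable section

open scoped Matrix.Norms.L2Operator ComplexOrder
open Matrix Finset NormedSpace

namespace Literature.MathematicalPhysics.QuantumLattice

variable {n : Type*} [Fintype n] [DecidableEq n] {H : Matrix n n ℂ}

section Eigenbasis

/-- `U⋆ H U = diag(λ)` for the eigenvector unitary of a Hermitian `H`
(Mathlib's `conjStarAlgAut_star_eigenvectorUnitary`, unfolded; plumbing). [folklore] -/
private theorem star_eigenvectorUnitary_mul_self_mul (hH : H.IsHermitian) :
    (star hH.eigenvectorUnitary : Matrix n n ℂ) * H * (hH.eigenvectorUnitary : Matrix n n ℂ) =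
      diagonal (fun i => (hH.eigenvalues i : ℂ)) := by
  have h := hH.conjStarAlgAut_star_eigenvectorUnitary
  rw [Unitary.conjStarAlgAut_star_apply] at h
  rw [h]
  rfl

/-- Conjugation is multiplicative: `(U⋆XU)(U⋆YU) = U⋆(XY)U` (plumbing). [folklore] -/
private theorem star_mul_mul_mul_star_mul_mul (hH : H.IsHermitian) (X Y : Matrix n n ℂ) :
    (star hH.eigenvectorUnitary : Matrix n n ℂ) * X * (hH.eigenvectorUnitary : Matrix n n ℂ) *
        ((star hH.eigenvectorUnitary : Matrix n n ℂ) * Y * (hH.eigenvectorUnitary : Matrix n n ℂ)) =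
      (star hH.eigenvectorUnitary : Matrix n n ℂ) * (X * Y) * (hH.eigenvectorUnitary : Matrix n n ℂ) := by
  set U : Matrix n n ℂ := (hH.eigenvectorUnitary : Matrix n n ℂ) with hU
  rw [Matrix.star_eq_conjTranspose,
    show Uᴴ * X * U * (Uᴴ * Y * U) = Uᴴ * X * (U * Uᴴ) * Y * U by simp only [Matrix.mul_assoc],
    eigenvectorUnitary_mul_conjTranspose_self hH, Matrix.mul_one]
  simp only [Matrix.mul_assoc]

/-- The conjugated matrix of `Aᴴ (HA − AH)`: with `A' = U⋆AU`, `D = diag(λ)`,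
`U⋆ (Aᴴ(HA − AH)) U = A'ᴴ (D A' − A' D)` (plumbing). [folklore] -/
private theorem star_mul_conjTranspose_mul_comm_mul (hH : H.IsHermitian) (A : Matrix n n ℂ) :
    (star hH.eigenvectorUnitary : Matrix n n ℂ) * (Aᴴ * (H * A - A * H)) *
        (hH.eigenvectorUnitary : Matrix n n ℂ) =
      ((star hH.eigenvectorUnitary : Matrix n n ℂ) * A * (hH.eigenvectorUnitary : Matrix n n ℂ))ᴴ *
        (diagonal (fun i => (hH.eigenvalues i : ℂ)) *
            ((star hH.eigenvectorUnitary : Matrix n n ℂ) * A * (hH.eigenvectorUnitary : Matrix n n ℂ)) -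
          (star hH.eigenvectorUnitary : Matrix n n ℂ) * A * (hH.eigenvectorUnitary : Matrix n n ℂ) *
            diagonal (fun i => (hH.eigenvalues i : ℂ))) := by
  have hAd : ((star hH.eigenvectorUnitary : Matrix n n ℂ) * A * (hH.eigenvectorUnitary : Matrix n n ℂ))ᴴ =
      (star hH.eigenvectorUnitary : Matrix n n ℂ) * Aᴴ * (hH.eigenvectorUnitary : Matrix n n ℂ) := by
    rw [Matrix.star_eq_conjTranspose, Matrix.conjTranspose_mul, Matrix.conjTranspose_mul,
      Matrix.conjTranspose_conjTranspose, Matrix.mul_assoc]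
  rw [hAd, ← star_eigenvectorUnitary_mul_self_mul hH, star_mul_mul_mul_star_mul_mul hH,
    star_mul_mul_mul_star_mul_mul hH, ← Matrix.sub_mul, ← Matrix.mul_sub,
    star_mul_mul_mul_star_mul_mul hH]

/-- **Eigenbasis form of the commutator row.** With `A' = U⋆AU`,
`Re Tr(e^{-βH} Aᴴ(HA − AH)) = Σᵢⱼ e^{-βλⱼ} (λᵢ − λⱼ) |A'ᵢⱼ|²` — the finite-dimensional
(matrix-element) form in which the energy–entropy balance of a Gibbs state is checked.
[cite: BratteliRobinsonII1997, Thm 5.3.15 (finite-dimensional eigenbasis form)] -/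
theorem re_trace_gibbsWeight_mul_conjTranspose_mul_comm (hH : H.IsHermitian) (β : ℝ)
    (A : Matrix n n ℂ) :
    ((gibbsWeight β H * (Aᴴ * (H * A - A * H))).trace).re =
      ∑ i, ∑ j, Real.exp (-β * hH.eigenvalues j) * (hH.eigenvalues i - hH.eigenvalues j) *
        ‖((star hH.eigenvectorUnitary : Matrix n n ℂ) * A * (hH.eigenvectorUnitary : Matrix n n ℂ)) i j‖ ^ 2 := by
  set A' : Matrix n n ℂ :=
    (star hH.eigenvectorUnitary : Matrix n n ℂ) * A * (hH.eigenvectorUnitary : Matrix n n ℂ) with hA'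
  rw [trace_gibbsWeight_mul_eq_sum hH, star_mul_conjTranspose_mul_comm_mul hH, ← hA', Complex.re_sum,
    Finset.sum_comm]
  refine Finset.sum_congr rfl fun j _ => ?_
  rw [Matrix.mul_apply, Finset.mul_sum, Complex.re_sum]
  refine Finset.sum_congr rfl fun i _ => ?_
  rw [Matrix.sub_apply, Matrix.diagonal_mul, Matrix.mul_diagonal, Matrix.conjTranspose_apply,
    Complex.star_def]
  have h1 : (starRingEnd ℂ) (A' i j) * ((hH.eigenvalues i : ℂ) * A' i j - A' i j * (hH.eigenvalues j : ℂ))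
      = ((hH.eigenvalues i : ℂ) - (hH.eigenvalues j : ℂ)) * (A' i j * (starRingEnd ℂ) (A' i j)) := by
    ring
  rw [h1, Complex.mul_conj, Complex.normSq_eq_norm_sq, ← Complex.ofReal_sub, ← Complex.ofReal_mul,
    ← Complex.ofReal_mul, Complex.ofReal_re]
  ring

end Eigenbasis

section ThermalSlack

/-- The scalar inequality `1 − e^{−x} ≤ x`, packaged as
`e^{-βb} − e^{-βa} ≤ β e^{-βb} (a − b)` (plumbing). [folklore] -/
private theorem exp_sub_exp_le_mul_mul_sub (β a b : ℝ) :
    Real.exp (-β * b) - Real.exp (-β * a) ≤ β * (Real.exp (-β * b) * (a - b)) := by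
  have h1 := Real.add_one_le_exp (-(β * (a - b)))
  have h2 : Real.exp (-β * a) = Real.exp (-β * b) * Real.exp (-(β * (a - b))) := by
    rw [← Real.exp_add]
    congr 1
    ring
  rw [h2]
  nlinarith [Real.exp_pos (-β * b), h1]

/-- **Thermal slack of the commutator (KKT) rows, trace form.** For Hermitian `H`, `β > 0` and
any `A`: `β⁻¹ (Re Tr(e^{-βH}AᴴA) − Re Tr(e^{-βH}AAᴴ)) ≤ Re Tr(e^{-βH} Aᴴ(HA − AH))`
(the energy–entropy-balance inequality `ω(A⋆[H,A]) ≥ β⁻¹ω(A⋆A) ln(ω(A⋆A)/ω(AA⋆))` of a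
`β`-KMS state, linearised by `a ln(a/b) ≥ a − b`; finite-dimensional Gibbs state, trace form).
[cite: FannesVerbeure1977, Thm (energy–entropy balance), linearised]
[cite: BratteliRobinsonII1997, Thm 5.3.15] -/
theorem inv_mul_sub_le_re_trace_gibbsWeight_comm (hH : H.IsHermitian) {β : ℝ} (hβ : 0 < β)
    (A : Matrix n n ℂ) :
    β⁻¹ * (((gibbsWeight β H * (Aᴴ * A)).trace).re - ((gibbsWeight β H * (A * Aᴴ)).trace).re) ≤
      ((gibbsWeight β H * (Aᴴ * (H * A - A * H))).trace).re := by
  rw [re_trace_gibbsWeight_mul_conjTranspose_mul_comm hH, re_trace_gibbsWeight_mul_conjTranspose_mul hH,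
    re_trace_gibbsWeight_mul_mul_conjTranspose hH, ← Finset.sum_sub_distrib, Finset.mul_sum]
  refine Finset.sum_le_sum fun i _ => ?_
  rw [← Finset.sum_sub_distrib, Finset.mul_sum]
  refine Finset.sum_le_sum fun j _ => ?_
  have hx : β⁻¹ * (Real.exp (-β * hH.eigenvalues j) - Real.exp (-β * hH.eigenvalues i)) ≤
      Real.exp (-β * hH.eigenvalues j) * (hH.eigenvalues i - hH.eigenvalues j) := by
    rw [inv_mul_le_iff₀ hβ]
    exact exp_sub_exp_le_mul_mul_sub β (hH.eigenvalues i) (hH.eigenvalues j)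
  have hsq : 0 ≤ ‖((star hH.eigenvectorUnitary : Matrix n n ℂ) * A *
      (hH.eigenvectorUnitary : Matrix n n ℂ)) i j‖ ^ 2 := sq_nonneg _
  calc β⁻¹ * (Real.exp (-β * hH.eigenvalues j) *
          ‖((star hH.eigenvectorUnitary : Matrix n n ℂ) * A * (hH.eigenvectorUnitary : Matrix n n ℂ)) i j‖ ^ 2 -
        Real.exp (-β * hH.eigenvalues i) *
          ‖((star hH.eigenvectorUnitary : Matrix n n ℂ) * A * (hH.eigenvectorUnitary : Matrix n n ℂ)) i j‖ ^ 2)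
        = β⁻¹ * (Real.exp (-β * hH.eigenvalues j) - Real.exp (-β * hH.eigenvalues i)) *
          ‖((star hH.eigenvectorUnitary : Matrix n n ℂ) * A * (hH.eigenvectorUnitary : Matrix n n ℂ)) i j‖ ^ 2 := by
          ring
    _ ≤ Real.exp (-β * hH.eigenvalues j) * (hH.eigenvalues i - hH.eigenvalues j) *
          ‖((star hH.eigenvectorUnitary : Matrix n n ℂ) * A * (hH.eigenvectorUnitary : Matrix n n ℂ)) i j‖ ^ 2 :=
          mul_le_mul_of_nonneg_right hx hsq

/-- **Thermal slack of the commutator (KKT) rows, Gibbs-state form.**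
`β⁻¹ (Re ⟨AᴴA⟩_β − Re ⟨AAᴴ⟩_β) ≤ Re ⟨Aᴴ(HA − AH)⟩_β` (linearised energy–entropy balance of
the finite-dimensional Gibbs = `β`-KMS state).
[cite: FannesVerbeure1977, Thm (energy–entropy balance), linearised]
[cite: BratteliRobinsonII1997, Thm 5.3.15] -/
theorem inv_mul_sub_le_re_gibbsState_comm (hH : H.IsHermitian) [Nonempty n] {β : ℝ} (hβ : 0 < β)
    (A : Matrix n n ℂ) :
    β⁻¹ * ((gibbsState β H (Aᴴ * A)).re - (gibbsState β H (A * Aᴴ)).re) ≤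
      (gibbsState β H (Aᴴ * (H * A - A * H))).re := by
  rw [hH.re_gibbsState, hH.re_gibbsState, hH.re_gibbsState, ← mul_sub, mul_left_comm]
  exact mul_le_mul_of_nonneg_left (inv_mul_sub_le_re_trace_gibbsWeight_comm hH hβ A)
    (inv_nonneg.mpr (hH.sum_exp_pos β).le)

/-- `Re ⟨A Aᴴ⟩_β ≤ ‖A‖²`: a state is bounded by the operator norm (`|ω(X)| ≤ ‖X‖`) and
`‖AAᴴ‖ = ‖A‖²` (C⋆-identity); here for the finite-dimensional Gibbs state.
[cite: BratteliRobinsonII1997, §5.3.1 (states bounded by the norm)] -/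
theorem re_gibbsState_mul_conjTranspose_le (hH : H.IsHermitian) [Nonempty n] (β : ℝ)
    (A : Matrix n n ℂ) : (gibbsState β H (A * Aᴴ)).re ≤ ‖A‖ ^ 2 := by
  have hZ : (partitionFn β H).re = ∑ i, Real.exp (-(β * hH.eigenvalues i)) := by
    rw [hH.partitionFn_eq_ofReal, Complex.ofReal_re]
  have hZpos := hH.sum_exp_pos β
  have hle := re_trace_gibbsWeight_mul_le hH β (A * Aᴴ)
  rw [hZ] at hle
  have hn : ‖A * Aᴴ‖ = ‖A‖ ^ 2 := by
    rw [← Matrix.star_eq_conjTranspose, CStarRing.norm_self_mul_star, sq]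
  rw [hH.re_gibbsState]
  calc (∑ i, Real.exp (-(β * hH.eigenvalues i)))⁻¹ * ((gibbsWeight β H * (A * Aᴴ)).trace).re
      ≤ (∑ i, Real.exp (-(β * hH.eigenvalues i)))⁻¹ *
          (‖A * Aᴴ‖ * ∑ i, Real.exp (-(β * hH.eigenvalues i))) :=
        mul_le_mul_of_nonneg_left hle (inv_nonneg.mpr hZpos.le)
    _ = ‖A‖ ^ 2 := by
        rw [hn]
        field_simp

/-- **Headline (thermal slack of the stationarity rows).** In the Gibbs state at temperature
`T = β⁻¹`, every ground-state stationarity row `Re ⟨Aᴴ[H,A]⟩ ≥ 0` holds up to a defect `T‖A‖²`: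
`Re ⟨Aᴴ(HA − AH)⟩_β ≥ −β⁻¹‖A‖²`, uniformly in the dimension (energy–entropy balance of the
Gibbs = `β`-KMS state, linearised, combined with `0 ≤ ⟨AᴴA⟩_β` and `⟨AAᴴ⟩_β ≤ ‖A‖²`).
[cite: FannesVerbeure1977, Thm (energy–entropy balance), corollary]
[cite: BratteliRobinsonII1997, Thm 5.3.15] -/
theorem neg_inv_mul_norm_sq_le_re_gibbsState_comm (hH : H.IsHermitian) [Nonempty n] {β : ℝ}
    (hβ : 0 < β) (A : Matrix n n ℂ) :
    -(β⁻¹ * ‖A‖ ^ 2) ≤ (gibbsState β H (Aᴴ * (H * A - A * H))).re := by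
  have h1 := inv_mul_sub_le_re_gibbsState_comm hH hβ A
  have h2 : 0 ≤ (gibbsState β H (Aᴴ * A)).re :=
    (Complex.nonneg_iff.mp
      (gibbsState_nonneg_of_posSemidef β hH (Matrix.posSemidef_conjTranspose_mul_self A))).1
  have h3 := re_gibbsState_mul_conjTranspose_le hH β A
  have h4 : β⁻¹ * (0 - ‖A‖ ^ 2) ≤
      β⁻¹ * ((gibbsState β H (Aᴴ * A)).re - (gibbsState β H (A * Aᴴ)).re) :=
    mul_le_mul_of_nonneg_left (by linarith) (inv_nonneg.mpr hβ.le)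
  linarith

end ThermalSlack

section GroundState

/-- **Ground-state side, identity.** If `Hψ = E₀ψ` with `E₀` the ground energy, then
`⟨ψ, Aᴴ(HA − AH)ψ⟩ = ⟨Aψ, (H − E₀)(Aψ)⟩` for every `A`: the commutator row of a ground-state
vector is the energy form of the excited trial vector `Aψ` (the algebraic ground-state
condition `−iω(A⋆δ(A)) ≥ 0`, `δ = i[H,·]`, unfolded for a vector state of a matrix
Hamiltonian). [cite: BratteliRobinsonII1997, Def 5.3.18 / Prop 5.3.19 (ground states)] -/
theorem dotProduct_conjTranspose_comm_mulVec_eq {ψ : n → ℂ}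
    (hψ : H *ᵥ ψ = (H.groundEnergy : ℂ) • ψ) (A : Matrix n n ℂ) :
    star ψ ⬝ᵥ (Aᴴ * (H * A - A * H)) *ᵥ ψ =
      star (A *ᵥ ψ) ⬝ᵥ (H - algebraMap ℝ (Matrix n n ℂ) H.groundEnergy) *ᵥ (A *ᵥ ψ) := by
  have hE : algebraMap ℝ (Matrix n n ℂ) H.groundEnergy *ᵥ (A *ᵥ ψ) =
      (H.groundEnergy : ℂ) • (A *ᵥ ψ) := by
    rw [Algebra.algebraMap_eq_smul_one, Matrix.smul_mulVec, Matrix.one_mulVec, Complex.coe_smul]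
  rw [Matrix.sub_mulVec, hE, ← Matrix.mulVec_mulVec, Matrix.sub_mulVec, ← Matrix.mulVec_mulVec,
    ← Matrix.mulVec_mulVec, hψ, Matrix.mulVec_smul, Matrix.dotProduct_mulVec, Matrix.star_mulVec]

/-- **Ground-state side, sign.** A ground-state vector satisfies every stationarity (KKT) row
exactly: `0 ≤ Re ⟨ψ, Aᴴ(HA − AH)ψ⟩` whenever `H` is Hermitian and `Hψ = E₀ψ` (`H − E₀ ⪰ 0`,
`posSemidef_sub_groundEnergy`). Compare `neg_inv_mul_norm_sq_le_re_gibbsState_comm`: the Gibbs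
state obeys the same rows up to `−β⁻¹‖A‖²`.
[cite: BratteliRobinsonII1997, Def 5.3.18 / Prop 5.3.19 (ground states)] -/
theorem re_dotProduct_conjTranspose_comm_mulVec_nonneg (hH : H.IsHermitian) {ψ : n → ℂ}
    (hψ : H *ᵥ ψ = (H.groundEnergy : ℂ) • ψ) (A : Matrix n n ℂ) :
    0 ≤ (star ψ ⬝ᵥ (Aᴴ * (H * A - A * H)) *ᵥ ψ).re := by
  rw [dotProduct_conjTranspose_comm_mulVec_eq hψ A]
  exact (Complex.nonneg_iff.mp
    ((posSemidef_sub_groundEnergy hH).dotProduct_mulVec_nonneg (A *ᵥ ψ))).1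

/-- The same for a ground-state vector in the tree's vocabulary `Matrix.IsGroundStateVector`
(`ψ ≠ 0 ∧ Hψ = E₀ψ`). [cite: BratteliRobinsonII1997, Def 5.3.18 / Prop 5.3.19 (ground states)] -/
theorem re_dotProduct_conjTranspose_comm_mulVec_nonneg_of_isGroundStateVector (hH : H.IsHermitian)
    {ψ : n → ℂ} (hψ : H.IsGroundStateVector ψ) (A : Matrix n n ℂ) :
    0 ≤ (star ψ ⬝ᵥ (Aᴴ * (H * A - A * H)) *ᵥ ψ).re :=
  re_dotProduct_conjTranspose_comm_mulVec_nonneg hH hψ.2 A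

end GroundState

section GroundStateMixed

/-! ### Ground states: first-order row and the mixed / tracial forms (appended 2026-08-26)

The stationarity rows in the two forms the cell's cards quantify over ("every ground state, pure or
mixed"): a density matrix `ρ ⪰ 0` supported on the ground space (`Hρ = E₀ρ`; the tree's
`IsGroundStateDensityMatrix` via `hamiltonian_mul_eq_smul_of_isGroundStateDensityMatrix`) and the
tracial ground-state functional `Matrix.groundStateFunctional` (the state behind
`dWaveSourceDensity`). First-order row `ω([H,A]) = 0`; second-order row `ω(Aᴴ[H,A]) ≥ 0`. -/

omit [DecidableEq n] in
/-- **First-order row, vector form.** If `H` is Hermitian and `Hψ = Eψ` with `E` real, then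
`⟨ψ, (HA − AH)ψ⟩ = 0` for every `A`.
[cite: BratteliRobinsonII1997, Def 5.3.18 / Prop 5.3.19 (ground states)] -/
theorem dotProduct_comm_mulVec_eq_zero (hH : H.IsHermitian) {ψ : n → ℂ} {E : ℝ}
    (hψ : H *ᵥ ψ = (E : ℂ) • ψ) (A : Matrix n n ℂ) :
    star ψ ⬝ᵥ (H * A - A * H) *ᵥ ψ = 0 := by
  have hψ' : star ψ ᵥ* H = (E : ℂ) • star ψ := by
    have h := congrArg star hψ
    rw [star_mulVec, hH.eq, star_smul] at h
    rw [h, Complex.star_def, Complex.conj_ofReal]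
  rw [Matrix.sub_mulVec, ← Matrix.mulVec_mulVec, ← Matrix.mulVec_mulVec, hψ, Matrix.mulVec_smul,
    dotProduct_sub, Matrix.dotProduct_mulVec, hψ', dotProduct_smul, smul_dotProduct, sub_self]

omit [DecidableEq n] in
/-- **First-order row, density-matrix form.** If `Hρ = E₀ρ` and `ρH = E₀ρ` (both hold for a
Hermitian `ρ` supported on an eigenspace of the Hermitian `H`), then `Tr(ρ(HA − AH)) = 0`.
[cite: BratteliRobinsonII1997, Def 5.3.18 / Prop 5.3.19 (ground states)] -/
theorem trace_mul_comm_eq_zero {ρ : Matrix n n ℂ} {E : ℂ} (hHρ : H * ρ = E • ρ)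
    (hρH : ρ * H = E • ρ) (A : Matrix n n ℂ) : (ρ * (H * A - A * H)).trace = 0 := by
  rw [Matrix.mul_sub, ← Matrix.mul_assoc, hρH, Matrix.smul_mul, ← Matrix.mul_assoc,
    Matrix.trace_sub, Matrix.trace_mul_comm (ρ * A) H, ← Matrix.mul_assoc, hHρ, Matrix.smul_mul,
    sub_self]

omit [DecidableEq n] in
/-- `ρH = E₀ρ` from `Hρ = E₀ρ` for Hermitian `H`, `ρ` and real `E₀` (adjoint). [folklore] -/
private theorem mul_eq_smul_of_mul_eq_smul (hH : H.IsHermitian) {ρ : Matrix n n ℂ}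
    (hρ : ρ.IsHermitian) {E : ℝ} (hHρ : H * ρ = (E : ℂ) • ρ) : ρ * H = (E : ℂ) • ρ := by
  have h := congrArg Matrix.conjTranspose hHρ
  rw [Matrix.conjTranspose_mul, hH.eq, hρ.eq, Matrix.conjTranspose_smul, hρ.eq, Complex.star_def,
    Complex.conj_ofReal] at h
  exact h

omit [DecidableEq n] in
/-- **First-order row for ground-supported density matrices**: `Hρ = E₀ρ` with `H`, `ρ` Hermitian
and `E₀` real ⇒ `Tr(ρ(HA − AH)) = 0`.
[cite: BratteliRobinsonII1997, Def 5.3.18 / Prop 5.3.19 (ground states)] -/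
theorem trace_mul_comm_eq_zero_of_hamiltonian_mul_eq_smul (hH : H.IsHermitian) {ρ : Matrix n n ℂ}
    (hρ : ρ.IsHermitian) {E : ℝ} (hHρ : H * ρ = (E : ℂ) • ρ) (A : Matrix n n ℂ) :
    (ρ * (H * A - A * H)).trace = 0 :=
  trace_mul_comm_eq_zero hHρ (mul_eq_smul_of_mul_eq_smul hH hρ hHρ) A

/-- **Second-order row, density-matrix form, identity**: if `Hρ = E₀ρ` (`E₀` the ground energy)
then `Tr(ρ Aᴴ(HA − AH)) = Tr(ρ Aᴴ(H − E₀)A)` (cyclicity only).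
[cite: BratteliRobinsonII1997, Def 5.3.18 / Prop 5.3.19 (ground states)] -/
theorem trace_mul_conjTranspose_comm_mul_eq {ρ : Matrix n n ℂ}
    (hHρ : H * ρ = (H.groundEnergy : ℂ) • ρ) (A : Matrix n n ℂ) :
    (ρ * (Aᴴ * (H * A - A * H))).trace =
      (ρ * (Aᴴ * (H - algebraMap ℝ (Matrix n n ℂ) H.groundEnergy) * A)).trace := by
  have e1 : ρ * (Aᴴ * (H * A - A * H)) = ρ * Aᴴ * H * A - ρ * Aᴴ * A * H := by
    simp only [Matrix.mul_sub, Matrix.mul_assoc]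
  have e2 : ρ * (Aᴴ * (H - algebraMap ℝ (Matrix n n ℂ) H.groundEnergy) * A) =
      ρ * Aᴴ * H * A - (H.groundEnergy : ℂ) • (ρ * Aᴴ * A) := by
    rw [Algebra.algebraMap_eq_smul_one, ← Complex.coe_smul]
    simp only [Matrix.mul_sub, Matrix.sub_mul, Matrix.mul_smul, Matrix.smul_mul, Matrix.mul_one,
      Matrix.mul_assoc]
  rw [e1, e2, Matrix.trace_sub, Matrix.trace_sub, Matrix.trace_smul, smul_eq_mul,
    Matrix.trace_mul_comm (ρ * Aᴴ * A) H, ← Matrix.mul_assoc, ← Matrix.mul_assoc, hHρ,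
    Matrix.smul_mul, Matrix.smul_mul, Matrix.trace_smul, smul_eq_mul]

open scoped MatrixOrder in
/-- **Second-order row for ground-supported density matrices**: `ρ ⪰ 0`, `Hρ = E₀ρ` with `E₀` the
ground energy ⇒ `0 ≤ Tr(ρ Aᴴ(HA − AH))` (as a nonnegative complex number: real part `≥ 0`,
imaginary part `0`). Every mixed ground state satisfies every KKT row exactly.
[cite: BratteliRobinsonII1997, Def 5.3.18 / Prop 5.3.19 (ground states)] -/
theorem trace_mul_conjTranspose_comm_mul_nonneg (hH : H.IsHermitian) {ρ : Matrix n n ℂ}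
    (hρ : ρ.PosSemidef) (hHρ : H * ρ = (H.groundEnergy : ℂ) • ρ) (A : Matrix n n ℂ) :
    0 ≤ (ρ * (Aᴴ * (H * A - A * H))).trace := by
  rw [trace_mul_conjTranspose_comm_mul_eq hHρ A]
  obtain ⟨B, hB⟩ := CStarAlgebra.nonneg_iff_eq_star_mul_self.mp hρ.nonneg
  have hM : (Aᴴ * (H - algebraMap ℝ (Matrix n n ℂ) H.groundEnergy) * A).PosSemidef :=
    (posSemidef_sub_groundEnergy hH).conjTranspose_mul_mul_same A
  rw [hB, Matrix.star_eq_conjTranspose, Matrix.mul_assoc, Matrix.trace_mul_comm]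
  exact (hM.mul_mul_conjTranspose_same B).trace_nonneg

/-- **First-order row, tracial ground state**: `ω_H(HA − AH) = 0` for the tracial ground-state
functional of a Hermitian `H` (`ω(HX) = E₀ω(X) = ω(XH)`).
[cite: BratteliRobinsonII1997, Def 5.3.18 / Prop 5.3.19 (ground states)] -/
theorem groundStateFunctional_comm_eq_zero (hH : H.IsHermitian) (A : Matrix n n ℂ) :
    H.groundStateFunctional (H * A - A * H) = 0 := by
  rw [map_sub, groundStateFunctional_hamiltonian_mul hH, groundStateFunctional_mul_hamiltonian,
    sub_self]

/-- **Second-order row, tracial ground state, identity**: `ω_H(Aᴴ(HA − AH)) = ω_H(Aᴴ(H − E₀)A)`.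
[cite: BratteliRobinsonII1997, Def 5.3.18 / Prop 5.3.19 (ground states)] -/
theorem groundStateFunctional_conjTranspose_comm_mul_eq (A : Matrix n n ℂ) :
    H.groundStateFunctional (Aᴴ * (H * A - A * H)) =
      H.groundStateFunctional (Aᴴ * (H - algebraMap ℝ (Matrix n n ℂ) H.groundEnergy) * A) := by
  rw [Algebra.algebraMap_eq_smul_one, Matrix.mul_sub, Matrix.mul_sub, Matrix.sub_mul, map_sub,
    map_sub, Matrix.mul_smul, Matrix.mul_one, Matrix.smul_mul, LinearMap.map_smul_of_tower,
    ← Matrix.mul_assoc, ← Matrix.mul_assoc, groundStateFunctional_mul_hamiltonian, Matrix.mul_assoc]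
  simp only [Complex.real_smul]

/-- **Second-order row, tracial ground state**: `0 ≤ ω_H(Aᴴ(HA − AH))` for every `A` — the state
`ω_H = Matrix.groundStateFunctional H` behind the tree's sourced order parameter satisfies every
KKT row exactly (cf. the Gibbs state: up to `−β⁻¹‖A‖²`).
[cite: BratteliRobinsonII1997, Def 5.3.18 / Prop 5.3.19 (ground states)] -/
theorem groundStateFunctional_conjTranspose_comm_mul_nonneg (hH : H.IsHermitian) (A : Matrix n n ℂ) :
    0 ≤ H.groundStateFunctional (Aᴴ * (H * A - A * H)) := by
  rw [groundStateFunctional_conjTranspose_comm_mul_eq A]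
  exact groundStateFunctional_nonneg_of_posSemidef H
    ((posSemidef_sub_groundEnergy hH).conjTranspose_mul_mul_same A)

end GroundStateMixed

end Literature.MathematicalPhysics.QuantumLattice
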